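import Mathlib
import HarnessLib
import Summits.ValiantsHypothesis.ValiantsHypothesis.Theorems.MonotoneRestorationOrbitRestorationLinearVolumeQPBlockDescent

/-!
# Route MonotoneRestoration — aside `OrbitRestorationLinearVolumeQP` (stmt-ValiantsHypothesis-18294):
# BLOCK DESCENT, image form — THE BIPARTITE NARROW SPAN AT LEVEL `n` IS EXACTLY THE IMAGE OF THE ONE-SORTED
# NARROW SPAN AT LEVEL `n + n` UNDER THE OFF-DIAGONAL BLOCK SUBSTITUTION

`BlockDescent.block_descent_span` (p829907) gives `Φ(N^di_w(n+n)) ⊆ N^bip_w(n)`.  The reverse inclusion is cheap: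
every generator `hom_{F,n}` (`tw F ≤ w`) is `Φ(hom_{F,n+n}) / N_F` with `N_F ≥ 1` the number of admissible
2-colourings (`BlockDescent.aeval_block_homPoly`; the standard colouring rows ↦ row block, columns ↦ column block is
always admissible), and `hom_{F,n+n}` is the one-sorted homomorphism polynomial of the oriented pattern, of the same
treewidth (`SubThresholdDescent.diHomPoly_orientFin`, `treewidth_orientFin`).  Hence

* `map_block_diNarrowSpan_eq_narrowSpan` — **`Φ(span{dihom_{D,n+n} : tw D ≤ w}) = span{hom_{F,n} : tw F ≤ w}`**:
  the bipartite narrow span of width `w` at level `n` is EXACTLY the block image of the one-sorted narrow span of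
  width `w` at level `n + n` (a characterisation of the registered stub's currency by the crux's currency one
  level up);
* `map_block_narrowSpan_eq_narrowSpan` — and also `Φ(span{hom_{F,n+n} : tw F ≤ w}) = span{hom_{F,n} : tw F ≤ w}`.

Honest label: bookkeeping corollary of block descent; the stub `stub_lvNarrowSpan`, R1 and VP ≠ VNP are NOT moved.
Def-free, route-independent helper (`--supports stmt-ValiantsHypothesis-18294`); nothing here is a named fact.

References: Dwivedi–Pago–Seppelt 2026 (arXiv:2601.09343) eq. (1); Dawar–Pago–Seppelt 2025 (arXiv:2502.06740) §7.
-/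

noncomputable section

open scoped Classical

-- `Summit.ValiantsHypothesis.ValiantsHypothesis.…` is the tree's single-conjunct layout (Sub = Summit).
set_option linter.dupNamespace false

namespace Summit.ValiantsHypothesis.ValiantsHypothesis.Theorems.BlockDescent

open Literature.Computability.AlgebraicComplexity MvPolynomial
open Literature.Combinatorics.SimpleGraph (treewidth)
open Summit.ValiantsHypothesis.ValiantsHypothesis.Theorems

variable {n : ℕ}

/-- The standard 2-colouring (rows in the row block, columns in the column block) is always admissible, so the
count `N_F` in `aeval_block_homPoly` is `≥ 1`. [folklore] -/
theorem one_le_card_blockColourings {a b : ℕ} (E : Multiset (Fin a × Fin b)) :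
    1 ≤ (Finset.univ.filter fun c : Fin (a + b) → Bool =>
      ∀ e ∈ E, c (finSumFinEquiv (Sum.inl e.1)) = false ∧ c (finSumFinEquiv (Sum.inr e.2)) = true).card := by
  refine Finset.card_pos.2 ⟨fun u => (finSumFinEquiv.symm u).elim (fun _ => false) (fun _ => true), ?_⟩
  simp only [Finset.mem_filter, Finset.mem_univ, true_and]
  intro e _
  simp only [Equiv.symm_apply_apply, Sum.elim_inl, Sum.elim_inr, and_self]

/-- **Every bipartite generator is a block image of a one-sorted narrow generator one level up**: for
`tw F ≤ w`, `hom_{F,n}` lies in `Φ(span{dihom_{D,n+n} : tw D ≤ w})`. [folklore] -/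
theorem homPoly_mem_map_block (φ : Fin (n + n) × Fin (n + n) → MvPolynomial (Fin n × Fin n) ℂ)
    (hφ : ∀ i j : Fin n, φ (finSumFinEquiv (Sum.inl i), finSumFinEquiv (Sum.inr j)) = X (i, j) ∧
      φ (finSumFinEquiv (Sum.inl i), finSumFinEquiv (Sum.inl j)) = 0 ∧
      φ (finSumFinEquiv (Sum.inr i), finSumFinEquiv (Sum.inl j)) = 0 ∧
      φ (finSumFinEquiv (Sum.inr i), finSumFinEquiv (Sum.inr j)) = 0)
    (w : ℕ) {a b : ℕ} (F : Multiset (Fin a × Fin b))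
    (hF : treewidth (SimpleGraph.fromRel fun u v : Fin a ⊕ Fin b =>
      ∃ e ∈ F, u = Sum.inl e.1 ∧ v = Sum.inr e.2) ≤ w) :
    homPoly F n ℂ ∈ (Submodule.span ℂ {q : MvPolynomial (Fin (n + n) × Fin (n + n)) ℂ |
      ∃ (a : ℕ) (D : Multiset (Fin a × Fin a)),
        treewidth (SimpleGraph.fromRel fun u v : Fin a => ∃ e ∈ D, u = e.1 ∧ v = e.2) ≤ w ∧
          q = diHomPoly D (n + n) ℂ}).map (aeval φ).toLinearMap := by
  set N := (Finset.univ.filter fun c : Fin (a + b) → Bool =>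
      ∀ e ∈ F, c (finSumFinEquiv (Sum.inl e.1)) = false ∧ c (finSumFinEquiv (Sum.inr e.2)) = true).card
    with hN
  have hNpos : (N : ℂ) ≠ 0 := by
    have := one_le_card_blockColourings F
    exact_mod_cast (by omega : N ≠ 0)
  -- the oriented pattern at level `n + n` is a one-sorted narrow generator
  have hmem : homPoly F (n + n) ℂ ∈ Submodule.span ℂ {q : MvPolynomial (Fin (n + n) × Fin (n + n)) ℂ |
      ∃ (a : ℕ) (D : Multiset (Fin a × Fin a)),
        treewidth (SimpleGraph.fromRel fun u v : Fin a => ∃ e ∈ D, u = e.1 ∧ v = e.2) ≤ w ∧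
          q = diHomPoly D (n + n) ℂ} := by
    refine Submodule.subset_span ⟨a + b, _, ?_, (SubThresholdDescent.diHomPoly_orientFin F (n + n)).symm⟩
    rw [SubThresholdDescent.treewidth_orientFin F]
    exact hF
  refine ⟨(N : ℂ)⁻¹ • homPoly F (n + n) ℂ, Submodule.smul_mem _ _ hmem, ?_⟩
  rw [AlgHom.toLinearMap_apply, map_smul, aeval_block_homPoly φ hφ F, ← hN, smul_smul, inv_mul_cancel₀ hNpos,
    one_smul]

/-- **THE BIPARTITE NARROW SPAN IS THE BLOCK IMAGE OF THE ONE-SORTED NARROW SPAN ONE LEVEL UP**: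
`Φ(span{dihom_{D,n+n} : tw D ≤ w}) = span{hom_{F,n} : tw F ≤ w}` (`⊆`: block descent `block_descent_span`;
`⊇`: `homPoly_mem_map_block`). [folklore] -/
theorem map_block_diNarrowSpan_eq_narrowSpan (φ : Fin (n + n) × Fin (n + n) → MvPolynomial (Fin n × Fin n) ℂ)
    (hφ : ∀ i j : Fin n, φ (finSumFinEquiv (Sum.inl i), finSumFinEquiv (Sum.inr j)) = X (i, j) ∧
      φ (finSumFinEquiv (Sum.inl i), finSumFinEquiv (Sum.inl j)) = 0 ∧
      φ (finSumFinEquiv (Sum.inr i), finSumFinEquiv (Sum.inl j)) = 0 ∧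
      φ (finSumFinEquiv (Sum.inr i), finSumFinEquiv (Sum.inr j)) = 0)
    (w : ℕ) :
    (Submodule.span ℂ {q : MvPolynomial (Fin (n + n) × Fin (n + n)) ℂ |
      ∃ (a : ℕ) (D : Multiset (Fin a × Fin a)),
        treewidth (SimpleGraph.fromRel fun u v : Fin a => ∃ e ∈ D, u = e.1 ∧ v = e.2) ≤ w ∧
          q = diHomPoly D (n + n) ℂ}).map (aeval φ).toLinearMap =
    Submodule.span ℂ {q : MvPolynomial (Fin n × Fin n) ℂ |
      ∃ (a b : ℕ) (F : Multiset (Fin a × Fin b)),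
        treewidth (SimpleGraph.fromRel fun u v : Fin a ⊕ Fin b =>
            ∃ e ∈ F, u = Sum.inl e.1 ∧ v = Sum.inr e.2) ≤ w ∧
          q = homPoly F n ℂ} := by
  refine le_antisymm ?_ (Submodule.span_le.2 ?_)
  · rintro _ ⟨p, hp, rfl⟩
    exact block_descent_span φ hφ w p hp
  · rintro _ ⟨a, b, F, hF, rfl⟩
    exact homPoly_mem_map_block φ hφ w F hF

/-- **… and the block image of the BIPARTITE narrow span one level up is again the bipartite narrow span**:
`Φ(span{hom_{F,n+n} : tw F ≤ w}) = span{hom_{F,n} : tw F ≤ w}`. [folklore] -/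
theorem map_block_narrowSpan_eq_narrowSpan (φ : Fin (n + n) × Fin (n + n) → MvPolynomial (Fin n × Fin n) ℂ)
    (hφ : ∀ i j : Fin n, φ (finSumFinEquiv (Sum.inl i), finSumFinEquiv (Sum.inr j)) = X (i, j) ∧
      φ (finSumFinEquiv (Sum.inl i), finSumFinEquiv (Sum.inl j)) = 0 ∧
      φ (finSumFinEquiv (Sum.inr i), finSumFinEquiv (Sum.inl j)) = 0 ∧
      φ (finSumFinEquiv (Sum.inr i), finSumFinEquiv (Sum.inr j)) = 0)
    (w : ℕ) :
    (Submodule.span ℂ {q : MvPolynomial (Fin (n + n) × Fin (n + n)) ℂ |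
      ∃ (a b : ℕ) (F : Multiset (Fin a × Fin b)),
        treewidth (SimpleGraph.fromRel fun u v : Fin a ⊕ Fin b =>
            ∃ e ∈ F, u = Sum.inl e.1 ∧ v = Sum.inr e.2) ≤ w ∧
          q = homPoly F (n + n) ℂ}).map (aeval φ).toLinearMap =
    Submodule.span ℂ {q : MvPolynomial (Fin n × Fin n) ℂ |
      ∃ (a b : ℕ) (F : Multiset (Fin a × Fin b)),
        treewidth (SimpleGraph.fromRel fun u v : Fin a ⊕ Fin b =>
            ∃ e ∈ F, u = Sum.inl e.1 ∧ v = Sum.inr e.2) ≤ w ∧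
          q = homPoly F n ℂ} := by
  refine le_antisymm ?_ (Submodule.span_le.2 ?_)
  · rw [Submodule.map_span_le]
    rintro _ ⟨a, b, F, hF, rfl⟩
    rw [AlgHom.toLinearMap_apply, aeval_block_homPoly φ hφ F]
    exact Submodule.smul_mem _ _ (Submodule.subset_span ⟨a, b, F, hF, rfl⟩)
  · rintro _ ⟨a, b, F, hF, rfl⟩
    set N := (Finset.univ.filter fun c : Fin (a + b) → Bool =>
        ∀ e ∈ F, c (finSumFinEquiv (Sum.inl e.1)) = false ∧ c (finSumFinEquiv (Sum.inr e.2)) = true).card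
      with hN
    have hNpos : (N : ℂ) ≠ 0 := by
      have := one_le_card_blockColourings F
      exact_mod_cast (by omega : N ≠ 0)
    refine ⟨(N : ℂ)⁻¹ • homPoly F (n + n) ℂ,
      Submodule.smul_mem _ _ (Submodule.subset_span ⟨a, b, F, hF, rfl⟩), ?_⟩
    rw [AlgHom.toLinearMap_apply, map_smul, aeval_block_homPoly φ hφ F, ← hN, smul_smul,
      inv_mul_cancel₀ hNpos, one_smul]


/-! ### v2 (append-only): the registered stub's conclusion, in the crux's one-sorted currency -/

/-- **THE STUB'S CONCLUSION IN ONE-SORTED CURRENCY (single level).**  A polynomial `p` at level `n` lies in the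
BIPARTITE narrow span of width `w` iff it is the off-diagonal block substitution of SOME polynomial in the
ONE-SORTED narrow span of width `w` at level `n + n` — a one-sortedly narrow LIFT (no size or `VP` condition on
the lift).  Compare the crux R1 (⟺ `LvDiNarrowSpan`): `f_n` itself lies in the one-sorted narrow span AT LEVEL `n`.
So, level by level, "registered stub" = "narrow lift one level up", "crux" = "narrow at the level itself".
[folklore] -/
theorem mem_narrowSpan_iff_exists_narrow_lift (φ : Fin (n + n) × Fin (n + n) → MvPolynomial (Fin n × Fin n) ℂ)
    (hφ : ∀ i j : Fin n, φ (finSumFinEquiv (Sum.inl i), finSumFinEquiv (Sum.inr j)) = X (i, j) ∧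
      φ (finSumFinEquiv (Sum.inl i), finSumFinEquiv (Sum.inl j)) = 0 ∧
      φ (finSumFinEquiv (Sum.inr i), finSumFinEquiv (Sum.inl j)) = 0 ∧
      φ (finSumFinEquiv (Sum.inr i), finSumFinEquiv (Sum.inr j)) = 0)
    (w : ℕ) (p : MvPolynomial (Fin n × Fin n) ℂ) :
    p ∈ Submodule.span ℂ {q : MvPolynomial (Fin n × Fin n) ℂ |
      ∃ (a b : ℕ) (F : Multiset (Fin a × Fin b)),
        treewidth (SimpleGraph.fromRel fun u v : Fin a ⊕ Fin b =>
            ∃ e ∈ F, u = Sum.inl e.1 ∧ v = Sum.inr e.2) ≤ w ∧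
          q = homPoly F n ℂ} ↔
    ∃ P ∈ Submodule.span ℂ {q : MvPolynomial (Fin (n + n) × Fin (n + n)) ℂ |
      ∃ (a : ℕ) (D : Multiset (Fin a × Fin a)),
        treewidth (SimpleGraph.fromRel fun u v : Fin a => ∃ e ∈ D, u = e.1 ∧ v = e.2) ≤ w ∧
          q = diHomPoly D (n + n) ℂ}, aeval φ P = p := by
  rw [← map_block_diNarrowSpan_eq_narrowSpan φ hφ w, Submodule.mem_map]
  simp only [AlgHom.toLinearMap_apply]

/-- **Family form.**  For any family `g` and block substitutions `φ_n`: the registered stub's conclusion for `g`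
(every level in the bipartite narrow span of width `(log₂ n + c)^c`) holds iff every `g_n` has a ONE-SORTEDLY
NARROW LIFT `P_n` at level `n + n` (`tw ≤ (log₂ n + c)^c`, `φ_n(P_n) = g_n`).  Under R1 the crux supplies
one-sorted narrowness of `g_{n+n}` itself, whose block image is `g↓_n`, not `g_n` — whence the LIFT residue of
`…BlockDescentLift.lean`. [folklore] -/
theorem stubConclusion_iff_narrow_lifts
    (φ : (n : ℕ) → Fin (n + n) × Fin (n + n) → MvPolynomial (Fin n × Fin n) ℂ)
    (hφ : ∀ n (i j : Fin n), φ n (finSumFinEquiv (Sum.inl i), finSumFinEquiv (Sum.inr j)) = X (i, j) ∧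
      φ n (finSumFinEquiv (Sum.inl i), finSumFinEquiv (Sum.inl j)) = 0 ∧
      φ n (finSumFinEquiv (Sum.inr i), finSumFinEquiv (Sum.inl j)) = 0 ∧
      φ n (finSumFinEquiv (Sum.inr i), finSumFinEquiv (Sum.inr j)) = 0)
    (g : (n : ℕ) → MvPolynomial (Fin n × Fin n) ℂ) :
    (∃ c : ℕ, ∀ n : ℕ, g n ∈ Submodule.span ℂ {q : MvPolynomial (Fin n × Fin n) ℂ |
      ∃ (a b : ℕ) (F : Multiset (Fin a × Fin b)),
        treewidth (SimpleGraph.fromRel fun u v : Fin a ⊕ Fin b =>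
            ∃ e ∈ F, u = Sum.inl e.1 ∧ v = Sum.inr e.2) ≤ (Nat.log 2 n + c) ^ c ∧
          q = homPoly F n ℂ}) ↔
    ∃ c : ℕ, ∀ n : ℕ, ∃ P ∈ Submodule.span ℂ {q : MvPolynomial (Fin (n + n) × Fin (n + n)) ℂ |
      ∃ (a : ℕ) (D : Multiset (Fin a × Fin a)),
        treewidth (SimpleGraph.fromRel fun u v : Fin a => ∃ e ∈ D, u = e.1 ∧ v = e.2) ≤ (Nat.log 2 n + c) ^ c ∧
          q = diHomPoly D (n + n) ℂ}, aeval (φ n) P = g n := by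
  constructor
  · rintro ⟨c, hc⟩
    exact ⟨c, fun n => (mem_narrowSpan_iff_exists_narrow_lift (φ n) (hφ n) _ _).1 (hc n)⟩
  · rintro ⟨c, hc⟩
    exact ⟨c, fun n => (mem_narrowSpan_iff_exists_narrow_lift (φ n) (hφ n) _ _).2 (hc n)⟩

end Summit.ValiantsHypothesis.ValiantsHypothesis.Theorems.BlockDescent

end
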